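import Summits.CriticalPhenomena.Ising3DConformalLimit.Theses.FKParityRobustness
import Summits.CriticalPhenomena.Ising3DConformalLimit.Theorems.FKParityRobustnessIndependentStrandsJoinPinchToTetraDefs
import Summits.CriticalPhenomena.Ising3DConformalLimit.Theorems.FKParityRobustnessIndependentStrandsJoinLimitUpgrade
import Summits.CriticalPhenomena.Ising3DConformalLimit.Theorems.FKParityRobustnessIndependentStrandsJoinStubPerScale
import Summits.CriticalPhenomena.Ising3DConformalLimit.Theorems.FKParityRobustnessIndependentStrandsJoinPinchToTetraReduction
import Summits.CriticalPhenomena.Ising3DConformalLimit.Theorems.FKParityRobustnessFarMergingGivesU4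
import HarnessLib

/-!
# The crux `IndependentStrandsJoin`, read in the scaling limit: modulo existence of the limit it is EXACTLY
# "the continuum Ursell function is non-zero at the regular tetrahedron" (registered sub-goal `stub_limitDictionary`)
(crux item stmt-CriticalPhenomena-14625, route `FKParityRobustness`; line `pinch-to-tetra`, lead
`prover-line-stmt-CriticalPhenomena-14625-c2-0`, 2026-08-17; `--supports stmt-CriticalPhenomena-14625`)

Theorems file (one `abbrev`: `yTetra`, the regular tetrahedron cast to `ℝ³`).  Let `(ρ, S)` be ANY non-degenerate pointwise scaling limit of the critical correlators
`criticalCorr 3` (`ρ > 0` on `(0,1]`) — the data posited by `LimitExists` (⊂ route crux `MoebiusLimit`, item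
stmt-CriticalPhenomena-1344; implied by item stmt-CriticalPhenomena-1981) — and `y_A ∈ (ℝ³)⁴` the regular
tetrahedron `tetra` cast to `ℝ³`.  Results (axioms `propext`, `Classical.choice`, `Quot.sound`):

* `limitU4_tetra_le_of_independentStrandsJoin` — the crux forces `U₄(S)(y_A) ≤ -c·S₂S₂ < 0` (crux ⟹ tetrahedral far
  merging at every scale, landed `tetraMergingIO_of_independentStrandsJoin`; transfer to the limit by the landed analytic
  core `limitConnectedFour_le_of_latticeBound`);
* `tetraMergingEventually_of_limitU4_tetra_neg` — conversely `U₄(S)(y_A) < 0` forces tetrahedral far merging at ALL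
  large lattice scales (the rescaled `U₄^crit(l·A)` and `GG` converge to `U₄(S)(y_A) < 0` and `S₂S₂ > 0`);
* `independentStrandsJoin_iff_limitU4_tetra_neg` = registered sub-goal `Theorems.stub_limitDictionary`:
  **`IndependentStrandsJoin ↔ U₄(S)(y_A) < 0`** for every such `(ρ, S)` (← with the landed `stub_limitUpgrade` and
  `stub_perScale`).  So, modulo existence of the limit, the rank-2 crux (uniform tetrahedral non-Gaussianity on the
  lattice, `∀ l`) is neither more nor less than NON-VANISHING OF THE CONTINUUM URSELL FUNCTION AT ONE CONFIGURATION —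
  the regular tetrahedron (cross-ratios `u = v = 1`, where the conformal bootstrap places the MINIMUM `Q = 0.683` of
  `⟨σσσσ⟩/Wick`, i.e. maximal non-Gaussianity; Rychkov–Simmons-Duffin–Zan 2017).  Its negation is "`y_A` is a zero of
  the non-positive (Lebowitz) function `U₄(S)`", which no proved property of `S` excludes (strategist census N6);
* `hasNontrivialU4_of_gap_pt` — SUMMIT-LEVEL CALIBRATION of the line `pinch-to-tetra`: its two shared inputs
  `EnergyGapPowerLaw` (item stmt-CriticalPhenomena-4469) and pinched transparency ALREADY give clause (iii)
  `HasNontrivialU4 S` for every non-degenerate limit, through the named thin shape (`thinMergingIO_criticalCorr` is far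
  merging along the injective lattice shape `Th(2^ℓ)`; landed `farMergingGivesU4_proof`) — the line's third input
  `OctaveTransfer` buys exactly the tetrahedral localisation `U₄(S)(y_A) < 0`, nothing at the level of (iii).

References: M. Aizenman, Comm. Math. Phys. 86 (1982) Prop. 5.3 [AizenmanCMP1982]; S. Rychkov, D. Simmons-Duffin,
B. Zan, JHEP (2017), arXiv:1612.02436, App. B (`Q_min` at the tetrahedral point) [RychkovSimmonsDuffinZan2017];
strategist census `Cruxes/IndependentStrandsJoin/STRATEGY-CENSUS.md` (p1: O1, N6).
-/

noncomputable section

open Filter Topology Finset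
open Literature.Probability.LatticeModels
open Summit.CriticalPhenomena.Ising3DConformalLimit.Theses.FKParityRobustness
open Summit.CriticalPhenomena.Ising3DConformalLimit.Theses.EnergyNotSigmaSquared (EnergyGapPowerLaw)
open Summit.CriticalPhenomena.Ising3DConformalLimit.Theorems.GapForcesFarMerging.Negative
  (cc2 Th smul_Th Th_injective PinchedTransparencyShape)
open Summit.CriticalPhenomena.Ising3DConformalLimit.FKParityRobustnessFarMergingGivesU4
  (injective_vecCons_pair injective_toLp_intCast latticeApprox_inv_natCast limitConnectedFour_le_of_latticeBound
   farMergingGivesU4_proof)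
open Summit.CriticalPhenomena.Ising3DConformalLimit.Cruxes.ParityRobustMerging.PlaquetteXorSurgery (tetra tetra_inj)
open Summit.CriticalPhenomena.Ising3DConformalLimit.Cruxes.IsingEuclidUpgradeR4NonGaussian.FreeCovarianceDeltaDichotomy
  (criticalCorr_two_pos')

namespace Summit.CriticalPhenomena.Ising3DConformalLimit.Cruxes.IndependentStrandsJoin.PinchToTetra

/-- The regular tetrahedron `tetra = ((−1,−1,−1),(1,1,−1),(1,−1,1),(−1,1,1))` as a configuration of `ℝ³`. -/
abbrev yTetra : Fin 4 → EuclideanSpace ℝ (Fin 3) := fun i => WithLp.toLp 2 fun k => ((tetra i k : ℤ) : ℝ)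

/-- `yTetra` is injective (non-coincident). [folklore] -/
theorem yTetra_injective : Function.Injective yTetra := injective_toLp_intCast tetra_inj

section limit

variable {ρ : ℝ → ℝ} {S : CorrFamily 3}

/-- **Crux ⟹ `U₄(S)(y_A) ≤ -c·S₂S₂`.**  The crux gives tetrahedral far merging at every lattice scale with one
constant `c > 0` (`tetraMergingIO_of_independentStrandsJoin`); along `l_j → ∞` the analytic core transfers the bound
to any pointwise scaling limit. [folklore] -/
theorem limitU4_tetra_le_of_independentStrandsJoin (hlim : HasPointwiseScalingLimit (criticalCorr 3) ρ S)
    (h : IndependentStrandsJoin) :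
    ∃ c : ℝ, 0 < c ∧ limitConnectedFour S yTetra ≤ -(c * (S 2 ![yTetra 0, yTetra 1] * S 2 ![yTetra 2, yTetra 3])) := by
  obtain ⟨c, hc, hio⟩ := tetraMergingIO_of_independentStrandsJoin h
  refine ⟨c, hc, ?_⟩
  -- scales `l_j ≥ j + 1` along which the lattice bound holds
  choose l hlge hlineq using fun j : ℕ => hio (j + 1)
  have hl_tend : Tendsto (fun j => ((l j : ℕ) : ℝ)) atTop atTop :=
    tendsto_natCast_atTop_atTop.comp (tendsto_atTop_mono hlge (tendsto_add_atTop_nat 1))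
  have hδ : Tendsto (fun j => ((l j : ℕ) : ℝ)⁻¹) atTop (𝓝[>] (0 : ℝ)) :=
    tendsto_inv_atTop_nhdsGT_zero.comp hl_tend
  have hz : ∀ (j : ℕ) (i : Fin 4), latticeApprox (((l j : ℕ) : ℝ)⁻¹) (yTetra i) = ((l j : ℕ) : ℤ) • tetra i :=
    fun j i => latticeApprox_inv_natCast (tetra i) (l j)
  refine limitConnectedFour_le_of_latticeBound hlim yTetra_injective hδ hz fun j => ?_
  have := hlineq j
  simp only [U4crit, GGcrit] at this
  exact this

/-- **`U₄(S)(y_A) < 0` ⟹ tetrahedral far merging at ALL large scales.**  The rescaled lattice Ursell function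
`ρ(1/l)⁴U₄^crit(l·A)` converges to `U₄(S)(y_A) =: A < 0` and `ρ(1/l)⁴GG` to `B = S₂S₂ > 0`; with `c = -A/(2B)`
eventually `ρ⁴(U₄ + c·GG) < 0`, and `ρ > 0` un-rescales. [folklore] -/
theorem tetraMergingEventually_of_limitU4_tetra_neg (hρ : ∀ δ ∈ Set.Ioc (0:ℝ) 1, 0 < ρ δ)
    (hlim : HasPointwiseScalingLimit (criticalCorr 3) ρ S) (hnd : IsNondegenerateTwoPoint S)
    (hA : limitConnectedFour S yTetra < 0) : TetraMergingEventually := by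
  have hy : Function.Injective yTetra := yTetra_injective
  set δ : ℕ → ℝ := fun l => ((l : ℝ))⁻¹ with hδ_def
  have hδ : Tendsto δ atTop (𝓝[>] (0 : ℝ)) :=
    tendsto_inv_atTop_nhdsGT_zero.comp tendsto_natCast_atTop_atTop
  have hz : ∀ (l : ℕ) (i : Fin 4), latticeApprox (δ l) (yTetra i) = (l : ℤ) • tetra i :=
    fun l i => latticeApprox_inv_natCast (tetra i) l
  have h4 : Tendsto (fun l : ℕ => ρ (δ l) ^ 4 * criticalCorr 3 4 (fun i => (l : ℤ) • tetra i)) atTop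
      (𝓝 (S 4 yTetra)) := by
    have hy' : yTetra ∈ NonCoincident 3 4 := hy
    refine (((hlim 4).tendsto_at hy').comp hδ).congr fun l => ?_
    have hzl : (fun i => latticeApprox (δ l) (yTetra i)) = fun i => (l : ℤ) • tetra i := funext (hz l)
    simp only [Function.comp_apply, rescaledCorrelator_apply, hzl]
  have h2 : ∀ a b : Fin 4, a ≠ b →
      Tendsto (fun l : ℕ => ρ (δ l) ^ 2 * criticalCorr 3 2 ![(l : ℤ) • tetra a, (l : ℤ) • tetra b]) atTop
        (𝓝 (S 2 ![yTetra a, yTetra b])) := by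
    intro a b hab
    have hmem : ![yTetra a, yTetra b] ∈ NonCoincident 3 2 := injective_vecCons_pair (hy.ne hab)
    refine (((hlim 2).tendsto_at hmem).comp hδ).congr fun l => ?_
    have hzl : (fun i => latticeApprox (δ l) (![yTetra a, yTetra b] i)) = ![(l : ℤ) • tetra a, (l : ℤ) • tetra b] := by
      funext i
      fin_cases i <;> simp [hz]
    simp only [Function.comp_apply, rescaledCorrelator_apply, hzl]
  set A : ℝ := limitConnectedFour S yTetra with hAdef
  set B : ℝ := S 2 ![yTetra 0, yTetra 1] * S 2 ![yTetra 2, yTetra 3] with hB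
  have hBpos : 0 < B :=
    mul_pos (hnd _ (injective_vecCons_pair (hy.ne (by decide))))
      (hnd _ (injective_vecCons_pair (hy.ne (by decide))))
  have hU : Tendsto (fun l : ℕ => ρ (δ l) ^ 4 * U4crit l) atTop (𝓝 A) := by
    have h := h4.sub ((((h2 0 1 (by decide)).mul (h2 2 3 (by decide))).add
      ((h2 0 2 (by decide)).mul (h2 1 3 (by decide)))).add
      ((h2 0 3 (by decide)).mul (h2 1 2 (by decide))))
    refine h.congr fun l => ?_
    simp only [U4crit]
    ring
  have hG : Tendsto (fun l : ℕ => ρ (δ l) ^ 4 * GGcrit l) atTop (𝓝 B) := by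
    have h := (h2 0 1 (by decide)).mul (h2 2 3 (by decide))
    refine h.congr fun l => ?_
    simp only [GGcrit]
    ring
  -- the constant
  set c : ℝ := -A / (2 * B) with hc
  have hcpos : 0 < c := div_pos (by linarith) (by positivity)
  have hneg : A + c * B < 0 := by
    have : c * B = -A / 2 := by rw [hc]; field_simp
    rw [this]; linarith
  have hev : ∀ᶠ l in atTop, ρ (δ l) ^ 4 * U4crit l + c * (ρ (δ l) ^ 4 * GGcrit l) < 0 :=
    (hU.add (hG.const_mul c)).eventually (gt_mem_nhds hneg)
  obtain ⟨l₁, hl₁⟩ := Filter.eventually_atTop.1 (hev.and (Filter.eventually_ge_atTop 1))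
  refine ⟨c, hcpos, l₁, fun l hl => ?_⟩
  obtain ⟨hlt, hl1⟩ := hl₁ l hl
  have hδmem : δ l ∈ Set.Ioc (0:ℝ) 1 := by
    have hl0 : (1 : ℝ) ≤ l := by exact_mod_cast hl1
    exact ⟨by positivity, inv_le_one_of_one_le₀ hl0⟩
  have hρpos : 0 < ρ (δ l) ^ 4 := pow_pos (hρ _ hδmem) 4
  have key : ρ (δ l) ^ 4 * (U4crit l + c * GGcrit l) < 0 := by
    have e : ρ (δ l) ^ 4 * (U4crit l + c * GGcrit l) =
        ρ (δ l) ^ 4 * U4crit l + c * (ρ (δ l) ^ 4 * GGcrit l) := by ring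
    rw [e]; exact hlt
  have : U4crit l + c * GGcrit l < 0 := by
    by_contra hcon
    push Not at hcon
    exact absurd (mul_nonneg hρpos.le hcon) (not_le.2 key)
  linarith

/-- `TetraMergingEventually → TetraMergingIO`. [folklore] -/
theorem tetraMergingIO_of_eventually (h : TetraMergingEventually) : TetraMergingIO := by
  obtain ⟨c, hc, l₁, hev⟩ := h
  exact ⟨c, hc, fun L₀ => ⟨max L₀ l₁, le_max_left _ _, hev _ (le_max_right _ _)⟩⟩

/-- **The crux in the limit (registered sub-goal `stub_limitDictionary`).**  For every non-degenerate pointwise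
scaling limit `(ρ, S)` of the critical correlators on `ℤ³`:  `IndependentStrandsJoin ↔ U₄(S)(y_A) < 0`.
(→ `limitU4_tetra_le_of_independentStrandsJoin`; ← `tetraMergingEventually_of_limitU4_tetra_neg` + the landed
`stub_limitUpgrade` and `stub_perScale`.) [folklore] -/
theorem independentStrandsJoin_iff_limitU4_tetra_neg (hρ : ∀ δ ∈ Set.Ioc (0:ℝ) 1, 0 < ρ δ)
    (hlim : HasPointwiseScalingLimit (criticalCorr 3) ρ S) (hnd : IsNondegenerateTwoPoint S) :
    IndependentStrandsJoin ↔ limitConnectedFour S yTetra < 0 := by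
  constructor
  · intro h
    obtain ⟨c, hc, hle⟩ := limitU4_tetra_le_of_independentStrandsJoin hlim h
    have hB : 0 < S 2 ![yTetra 0, yTetra 1] * S 2 ![yTetra 2, yTetra 3] :=
      mul_pos (hnd _ (injective_vecCons_pair (yTetra_injective.ne (by decide))))
        (hnd _ (injective_vecCons_pair (yTetra_injective.ne (by decide))))
    nlinarith
  · intro hA
    exact Summit.CriticalPhenomena.Ising3DConformalLimit.Theorems.stub_limitUpgrade ⟨ρ, S, hρ, hlim, hnd⟩
      (tetraMergingIO_of_eventually (tetraMergingEventually_of_limitU4_tetra_neg hρ hlim hnd hA))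
      Summit.CriticalPhenomena.Ising3DConformalLimit.Theorems.stub_perScale

end limit

/-- `LimitExists`-form of the dictionary: the crux holds iff the continuum Ursell function of SOME (equivalently, by
the theorem above, EVERY) non-degenerate pointwise scaling limit is negative at the regular tetrahedron. [folklore] -/
theorem independentStrandsJoin_iff_of_limitExists (hL : LimitExists) :
    IndependentStrandsJoin ↔ ∀ (ρ : ℝ → ℝ) (S : CorrFamily 3), (∀ δ ∈ Set.Ioc (0:ℝ) 1, 0 < ρ δ) →
      HasPointwiseScalingLimit (criticalCorr 3) ρ S → IsNondegenerateTwoPoint S → limitConnectedFour S yTetra < 0 := by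
  constructor
  · intro h ρ S hρ hlim hnd
    exact (independentStrandsJoin_iff_limitU4_tetra_neg hρ hlim hnd).1 h
  · intro h
    obtain ⟨ρ, S, hρ, hlim, hnd⟩ := hL
    exact (independentStrandsJoin_iff_limitU4_tetra_neg hρ hlim hnd).2 (h ρ S hρ hlim hnd)

/-! ## Summit-level calibration of the line's shared inputs -/

/-- **GAP + pinched transparency already give clause (iii) for every limit.**  `thinMergingIO_criticalCorr` is far
merging along infinitely many dilations of the INJECTIVE lattice shape `Th(2^ℓ)` with constant `1/2`; the landed
`farMergingGivesU4_proof` (item stmt-CriticalPhenomena-4471) turns it into `HasNontrivialU4 S` for every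
non-degenerate pointwise scaling limit `S`.  (So of the line's three open correlator inputs only `OctaveTransfer`
is specific to the tetrahedral crux.) [folklore] -/
theorem hasNontrivialU4_of_gap_pt (hgap : EnergyGapPowerLaw) (hpt : PinchedTransparencyShape cc2 (criticalCorr 3 4)) :
    ∀ (ρ : ℝ → ℝ) (S : CorrFamily 3), (∀ δ ∈ Set.Ioc (0:ℝ) 1, 0 < ρ δ) →
      HasPointwiseScalingLimit (criticalCorr 3) ρ S → IsNondegenerateTwoPoint S → HasNontrivialU4 S := by
  obtain ⟨ℓ, -, hio⟩ := thinMergingIO_criticalCorr hgap hpt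
  refine farMergingGivesU4_proof ⟨1 / 2, by norm_num, Th (2 ^ ℓ), Th_injective Nat.one_le_two_pow, ?_⟩
  intro L₀
  obtain ⟨L, hL, hle⟩ := hio L₀
  exact ⟨L, hL, hle⟩

end Summit.CriticalPhenomena.Ising3DConformalLimit.Cruxes.IndependentStrandsJoin.PinchToTetra

/-! ## The registered sub-goal `stub_limitDictionary` -/

namespace Summit.CriticalPhenomena.Ising3DConformalLimit.Theorems

open Summit.CriticalPhenomena.Ising3DConformalLimit.Cruxes.IndependentStrandsJoin.PinchToTetra
open Summit.CriticalPhenomena.Ising3DConformalLimit.Cruxes.ParityRobustMerging.PlaquetteXorSurgery (tetra)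

/-- **Registered sub-goal `stub_limitDictionary` of the crux `IndependentStrandsJoin`** (stmt-CriticalPhenomena-14625):
for every non-degenerate pointwise scaling limit `(ρ, S)` of `criticalCorr 3`, the crux holds iff the continuum
Ursell function `U₄(S)` is negative at the regular tetrahedron. -/
theorem stub_limitDictionary :
    ∀ (ρ : ℝ → ℝ) (S : CorrFamily 3), (∀ δ ∈ Set.Ioc (0:ℝ) 1, 0 < ρ δ) →
      HasPointwiseScalingLimit (criticalCorr 3) ρ S → IsNondegenerateTwoPoint S →
      (IndependentStrandsJoin ↔
        limitConnectedFour S (fun i => WithLp.toLp 2 fun k => ((tetra i k : ℤ) : ℝ)) < 0) :=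
  fun _ _ hρ hlim hnd => independentStrandsJoin_iff_limitU4_tetra_neg hρ hlim hnd

end Summit.CriticalPhenomena.Ising3DConformalLimit.Theorems

end
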